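import Summits.ResolutionOfSingularities.ResolutionOfSingularities.Theorems.PurelyInseparableDim4PointTree
import Literature.AlgebraicGeometry.Resolution.KollarFunctorLinearCentre
import HarnessLib

/-!
# Purely inseparable four-folds: ROOT CHARTS at every closed order-`p` point of `z^p + F`, and termination ⇒ order
# reduction in the isolated regime WITHOUT a hypothesis on the origin (brick TY-3k part 4 «POINT ROOTS», cell `res-dim4-pi`)

[OURS · counted 0] (D-0157 DOOR 2; closes the root of the finite-tree assembly of `PIDim4.TerminationImpliesOrderReduction`
for MODE 0 (point centres) in the ISOLATED regime (typ-3 memo §D); host item stmt-ResolutionOfSingularities-16155,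
helper). Resolution of singularities in dimension ≥ 4 / characteristic `p` is NOT proved here or anywhere in this
programme.

`…PointTree.exists_isMarkedResolution_of_acc_of_finite` still assumed that the origin is the ONLY closed order-`p` point
of `(z^p + F)·𝒪` on `𝔸⁵_K`. Here every closed order-`p` point `(a, b)` (`a^p + F(b) = 0`, `K = K̄`) gets its own FULL
chart by RE-CENTRING: the translation `(z, x) ↦ (z + a, x + b)` followed by the cleaning `z ↦ z + h(x)` (Hauser's
elimination of `p`-th power monomials; `h(0) = 0` because the point lies on the hypersurface) is a `K`-automorphism
`Θ` of `K[z, x]` with `Θ(z^p + F) = z^p + F_{(a,b)}`, `F_{(a,b)} = deletePthPowers p (F(x + b))`.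

* `deletePthPowers_add_C`, `hyp_injective`, `isClean_deletePthPowers`, `deletePthPowers_translate_ne_zero`,
  `ordAlong_univ_deletePthPowers_translate` — algebra of the re-centred state: clean, non-zero (for `F ≠ 0` clean),
  `p`-fold at an order-`p` point;
* **`exists_chart_recenter`** — the full chart `φ = Spec Θ : 𝔸⁵_K ⟶ 𝔸⁵_K` (an automorphism) with `φ(ξ) = (a, b)` and
  `(hypSheaf p F).comap φ = hypSheaf p F_{(a,b)}` (`K` perfect);
* **`exists_isMarkedResolution_of_finite_of_forall_acc`** — `K = K̄` of characteristic `p`, `F ≠ 0` clean (NO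
  hypothesis at the origin): if along every admissible blow-up sequence of `M₀ = (𝔸⁵_K, (z^p + F)·𝒪, [], p)` the closed
  points of order `≥ p` are finitely many (ISOLATED regime) and the point-centre walk is well-founded below the
  re-centred state `(F_{(a,b)}, 0, ∅)` of every closed order-`p` point `(a, b)`, then
  `∃ X′ π M′, IsMarkedResolution ⟨hypSheaf p F, [], p⟩ π M′` — the conclusion of `PIDim4.OrderReduction p` for `F`.

NOT `OrderReduction p`: positive-dimensional order-`p` loci (excluded by the isolated-regime hypothesis) need coordinate
centres of positive dimension and a global centre rule (typ-2 lane). AI-produced formalisation, weaker than expert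
review. bears_on: LADDER-RESOLUTION:D157-DOOR2 (res-dim4-pi · TY-3k).
-/

set_option linter.dupNamespace false -- D-0017: single-problem summit path `Summit.<S>.<S>.…` by design

noncomputable section

open MvPolynomial Finset CategoryTheory AlgebraicGeometry Opposite TopologicalSpace

namespace Summit.ResolutionOfSingularities.ResolutionOfSingularities.Theorems.PIDim4

open Literature.AlgebraicGeometry.Resolution
open Literature.AlgebraicGeometry.Resolution.Hauser2010
open Literature.AlgebraicGeometry.Resolution.AffinePointBlowup (P A γ coord Wtop ξ)

namespace Equimultiple

/-! ## 1. Algebra of the re-centred state `deletePthPowers p (F(x + b))` -/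

section Algebra

variable {K : Type} [Field K] {p : ℕ} [hp : Fact p.Prime] [CharP K p]

omit hp [CharP K p] in
/-- Deleting `p`-th power monomials ignores constants (the constant monomial is a `p`-th power).
[cite: Hauser2010, §G (cleaning)] -/
theorem deletePthPowers_add_C (G : MvPolynomial (Fin 4) K) (c : K) :
    deletePthPowers p (G + C c) = deletePthPowers p G := by
  classical
  ext d
  rw [coeff_deletePthPowers, coeff_deletePthPowers]
  split_ifs with h
  · rfl
  · have hd : d ≠ 0 := by
      rintro rfl
      exact h fun i hi => by simp at hi
    rw [coeff_add, coeff_C, if_neg (Ne.symm hd), add_zero]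

omit hp [CharP K p] in
/-- The constant term of a cleaned polynomial vanishes. [cite: Hauser2010, §G (cleaning)] -/
theorem constantCoeff_deletePthPowers (G : MvPolynomial (Fin 4) K) : constantCoeff (deletePthPowers p G) = 0 := by
  classical
  change coeff 0 (deletePthPowers p G) = 0
  rw [coeff_deletePthPowers]
  exact if_pos fun i hi => by simp at hi

omit hp [CharP K p] in
/-- `z^p + A = z^p + B ⇒ A = B`. [folklore] -/
theorem hyp_injective {A₁ A₂ : MvPolynomial (Fin 4) K} (h : hyp p A₁ = hyp p A₂) : A₁ = A₂ := by
  unfold hyp at h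
  exact rename_injective _ (Fin.succ_injective 4) (add_left_cancel h)

omit hp [CharP K p] in
/-- A cleaned polynomial is clean. [cite: HauserPerlega2019PRIMS, §2 (cleaning)] -/
theorem isClean_deletePthPowers (G : MvPolynomial (Fin 4) K) :
    Literature.Barriers.ResolutionOfSingularities.HauserPerlega.IsClean p (deletePthPowers p G) := by
  classical
  intro d hd hpth
  apply MvPolynomial.mem_support_iff.mp hd
  rw [coeff_deletePthPowers, if_pos hpth]

/-- **The re-centred state of a non-zero clean `F` is non-zero**: `deletePthPowers p (F(x + b)) ≠ 0` (else `F` itself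
would be a sum of `p`-th power monomials, i.e. `0` after cleaning). [cite: HauserPerlega2019PRIMS, §2 (cleaning)] -/
theorem deletePthPowers_translate_ne_zero [DecidableEq K] {F : MvPolynomial (Fin 4) K} (hF : F ≠ 0)
    (hclean : Literature.Barriers.ResolutionOfSingularities.HauserPerlega.IsClean p F) (b : Fin 4 → K) :
    deletePthPowers p (PointBlowup.translate b F) ≠ 0 := by
  intro h0
  have h1 := deletePthPowers_translate_eq_zero (p := p) (-b) h0
  rw [MohAlong.translate_translate, neg_add_cancel, PointBlowup.translate_zero,
    Literature.Barriers.ResolutionOfSingularities.HauserPerlega.deletePthPowers_eq_self hclean] at h1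
  exact hF h1

omit hp [CharP K p] in
/-- **The re-centred state at an order-`p` point is `p`-fold**: if every non-constant monomial of degree `< p` of
`F(x + b)` vanishes then `p ≤ ord₀ (deletePthPowers p (F(x + b)))` (in the `ordAlong univ` form of the walk).
[cite: Hauser2010, §F (equiconstant points)] -/
theorem ordAlong_univ_deletePthPowers_translate [DecidableEq K] (F : MvPolynomial (Fin 4) K) (b : Fin 4 → K)
    (H : ∀ d : Fin 4 →₀ ℕ, d ≠ 0 → d.degree < p → coeff d (PointBlowup.translate b F) = 0) :
    (p : ℕ∞) ≤ CentreBlowup.ordAlong (Finset.univ : Finset (Fin 4)) (deletePthPowers p (PointBlowup.translate b F)) := by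
  refine Finset.le_inf fun d hd => ?_
  rw [CentreBlowup.degIn_univ]
  have hc := MvPolynomial.mem_support_iff.mp hd
  rw [coeff_deletePthPowers] at hc
  split_ifs at hc with hpth
  · exact absurd rfl hc
  · have hd0 : d ≠ 0 := by
      rintro rfl
      exact hpth fun i hi => by simp at hi
    by_contra hlt
    exact hc (H d hd0 (by exact_mod_cast not_le.mp hlt))

end Algebra

/-! ## 2. The full chart at a rational point of the hypersurface (re-centring) -/

section Recenter

variable {K : Type} [Field K] {p : ℕ} [hp : Fact p.Prime] [CharP K p]

/-- **ROOT CHART BY RE-CENTRING.** `K` perfect of characteristic `p`, `F ∈ K[x₁..x₄]`, `(a, b)` a rational point of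
`V(z^p + F)` (`a^p + F(b) = 0`) and `x` the corresponding closed point of `𝔸⁵_K`. Then there is an automorphism
`φ = Spec Θ` of `𝔸⁵_K` (`Θ` = translation to `(a, b)` followed by Hauser's cleaning `z ↦ z + h(x)`, `h(0) = 0`) with
`φ(ξ) = x` and `(z^p + F)·𝒪 pulled back along φ = (z^p + deletePthPowers p (F(x + b)))·𝒪` — a full affine chart at
`x` in the sense of `…PointStepPackage`. [cite: Hauser2010, §G (cleaning of p-th power monomials)]
[cite: HauserPerlega2019PRIMS, §2 (cleaning z ↦ z − F(b)^{1/p})] -/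
theorem exists_chart_recenter [PerfectRing K p] (F : MvPolynomial (Fin 4) K) (a : K) (b : Fin 4 → K)
    (hab : a ^ p + MvPolynomial.eval b F = 0) {x : P 4 K}
    (hx : x.asIdeal = MvPolynomial.vanishingIdeal K {(Fin.cons a b : Fin (4 + 1) → K)}) :
    ∃ (φ : P 4 K ⟶ P 4 K) (_ : IsOpenImmersion φ), φ (ξ 4 K) = x ∧
      (hypSheaf p F).comap φ = hypSheaf p (deletePthPowers p (PointBlowup.translate b F)) := by
  -- the translated equation `z^p + G`, `G = F(x + b) + a^p`, and its cleaning `θ`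
  obtain ⟨θ, h, h0, hs, hθ⟩ :=
    ChartDictionary.exists_clean_hyp_eq_deletePthPowers_pow (K := K) p 1 (PointBlowup.translate b F + C (a ^ p))
  rw [pow_one] at hθ
  have hθ' := ChartDictionary.clean_hyp p h0 hs 1 (PointBlowup.translate b F + C (a ^ p))
  rw [pow_one] at hθ'
  -- `h(0) = 0`: the point lies on the hypersurface
  have hG0 : constantCoeff (PointBlowup.translate b F + C (a ^ p)) = 0 := by
    rw [map_add, constantCoeff_C, show constantCoeff (PointBlowup.translate b F) = MvPolynomial.eval b F from
      coeff_zero_translate b F, add_comm]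
    exact hab
  have hh0 : constantCoeff h = 0 := by
    have h1 : PointBlowup.translate b F + C (a ^ p) + h ^ p =
        deletePthPowers p (PointBlowup.translate b F + C (a ^ p)) := hyp_injective (hθ'.symm.trans hθ)
    have h2 := congrArg constantCoeff h1
    rw [map_add, hG0, zero_add, constantCoeff_deletePthPowers, map_pow] at h2
    exact pow_eq_zero_iff (hp.out.ne_zero) |>.mp h2
  -- the translated hypersurface equation is `z^p + G`
  have hGhyp : (X 0 ^ p + C (a ^ p) + rename Fin.succ (PointBlowup.translate b F) : A 4 K) =
      hyp p (PointBlowup.translate b F + C (a ^ p)) := by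
    rw [hyp, map_add, rename_C, add_assoc, add_comm (C (a ^ p))]
  -- the composite automorphism `Θ = θ ∘ (translation to (a, b))`
  let τ : A 4 K ≃ₐ[K] A 4 K := translateEquiv (Fin.cons a b : Fin (4 + 1) → K)
  let Θ : A 4 K ≃ₐ[K] A 4 K := τ.trans θ
  have hτ : ∀ g : A 4 K, τ g = PointBlowup.translate (Fin.cons a b : Fin (4 + 1) → K) g := fun g => rfl
  have hΘ0 : Θ (X 0) = X 0 + rename Fin.succ (h + C a) := by
    change θ (τ (X 0)) = _
    rw [hτ, PointBlowup.translate, aeval_X, Fin.cons_zero, map_add, h0, show θ (C a) = C a from θ.commutes a,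
      map_add, rename_C, add_assoc]
  have hΘs : ∀ i : Fin 4, Θ (X i.succ) = X i.succ + C (b i) := by
    intro i
    change θ (τ (X i.succ)) = _
    rw [hτ, PointBlowup.translate, aeval_X, Fin.cons_succ, map_add, hs i, show θ (C (b i)) = C (b i) from
      θ.commutes (b i)]
  have hΘF : Θ (hyp p F) = hyp p (deletePthPowers p (PointBlowup.translate b F)) := by
    change θ (τ (hyp p F)) = _
    rw [hτ, translate_hyp, hGhyp, hθ, deletePthPowers_add_C]
  haveI := isOpenImmersion_specMap_algEquiv Θ
  refine ⟨Spec.map (CommRingCat.ofHom (Θ : A 4 K →+* A 4 K)), inferInstance, ?_, ?_⟩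
  · apply PrimeSpectrum.ext
    rw [specMap_algEquiv_ξ_asIdeal Θ (h + C a) b hΘ0 hΘs, hx, map_add, hh0, constantCoeff_C, zero_add]
  · rw [ChartDictionary.comap_hypSheaf_specMap, show (Θ : A 4 K →+* A 4 K) (hyp p F) = Θ (hyp p F) from rfl, hΘF]
    rfl

end Recenter

/-! ## 3. Termination ⇒ order reduction in the isolated regime, all roots -/

section AllRoots

variable {K : Type} [Field K] {p : ℕ} [hp : Fact p.Prime] [CharP K p]

/-- **TERMINATION ⇒ ORDER REDUCTION (MODE 0, ISOLATED regime, no hypothesis at the origin).** `K = K̄` of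
characteristic `p`, `F ≠ 0` clean. Suppose (ISOLATED regime) that along every admissible blow-up sequence of
`M₀ = (𝔸⁵_K, (z^p + F)·𝒪, [], p)` the closed points of order `≥ p` are finitely many, and (TERMINATION) that the
point-centre walk is well-founded (`Acc`) below the re-centred state `(deletePthPowers p (F(x + b)), 0, ∅)` of every
closed order-`p` point `(a, b)` of `z^p + F` (`a^p + F(b) = 0` and the non-constant monomials of degree `< p` of
`F(x + b)` vanish). Then `M₀` admits a marked resolution (BGMW Def. 3.1.3): the conclusion of `PIDim4.OrderReduction p`
for `F`. NOT `OrderReduction p`. [cite: BierstoneGrigorievMilmanWlodarczyk2011, Def. 3.1.3]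
[cite: Hauser2010, §§F–G] [cite: Hironaka1964, Main Theorem I (the characteristic-zero statement whose analogue is asked)] -/
theorem exists_isMarkedResolution_of_finite_of_forall_acc [IsAlgClosed K] [DecidableEq K] (F : MvPolynomial (Fin 4) K)
    (hF : F ≠ 0) (hclean : Literature.Barriers.ResolutionOfSingularities.HauserPerlega.IsClean p F)
    (hfin : ∀ (X' : Scheme.{0}) (σ : X' ⟶ P 4 K) (M' : MarkedIdeal X'),
      IsMultipleBlowup (⟨hypSheaf p F, [], p⟩ : MarkedIdeal (P 4 K)) σ M' →
      {w : X' | IsClosed ({w} : Set X') ∧ (p : ℕ∞) ≤ idealOrder M'.ideal w}.Finite)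
    (hacc : ∀ (a : K) (b : Fin 4 → K), a ^ p + MvPolynomial.eval b F = 0 →
      (∀ d : Fin 4 →₀ ℕ, d ≠ 0 → d.degree < p → coeff d (PointBlowup.translate b F) = 0) →
      Acc (fun s' s : State K => Edge p Finset.univ s s')
        (⟨deletePthPowers p (PointBlowup.translate b F), 0, ∅⟩ : State K)) :
    ∃ (X' : Scheme.{0}) (π : X' ⟶ P 4 K) (M' : MarkedIdeal X'),
      IsMarkedResolution (⟨hypSheaf p F, [], p⟩ : MarkedIdeal (P 4 K)) π M' := by
  classical
  haveI : PerfectRing K p := PerfectRing.ofSurjective K p fun x => IsAlgClosed.exists_pow_nat_eq x hp.out.pos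
  set M₀ : MarkedIdeal (P 4 K) := ⟨hypSheaf p F, [], p⟩ with hM₀
  have hE₀ : HasSNC M₀.boundary :=
    hasSNC_nil_of_isRegular (Literature.AlgebraicGeometry.Hironaka2017.Lib.AffinePointBlowupLSB.isRegular_Z 4 K)
  -- the root configuration: all closed order-`p` points, with their re-centred states
  set pts : Finset (P 4 K) := (hfin (P 4 K) (𝟙 _) M₀ (IsMultipleBlowup.refl _)).toFinset with hpts
  have hmem : ∀ x : P 4 K, x ∈ pts ↔ IsClosed ({x} : Set (P 4 K)) ∧ (p : ℕ∞) ≤ idealOrder M₀.ideal x := fun x => by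
    rw [hpts, Set.Finite.mem_toFinset, Set.mem_setOf_eq]
  set st : P 4 K → State K := fun x =>
    if hx : IsClosed ({x} : Set (P 4 K)) then
      ⟨deletePthPowers p (PointBlowup.translate (exists_eq_vanishingIdeal_cons_of_isClosed hx).choose_spec.choose F),
        0, ∅⟩
    else ⟨F, 0, ∅⟩ with hst
  -- the data at each root point
  have hdata : ∀ x ∈ pts, (st x).F ≠ 0 ∧
      Literature.Barriers.ResolutionOfSingularities.HauserPerlega.IsClean p (st x).F ∧
      (p : ℕ∞) ≤ CentreBlowup.ordAlong (Finset.univ : Finset (Fin 4)) (st x).F ∧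
      Acc (fun s' s : State K => Edge p Finset.univ s s') (st x) ∧
      ∃ (Y : Scheme.{0}) (φ : Y ⟶ P 4 K) (ψ : Y ⟶ P 4 K) (_ : IsOpenImmersion φ) (_ : IsOpenImmersion ψ) (y : Y),
        φ y = x ∧ ψ y = ξ 4 K ∧ M₀.ideal.comap φ = (hypSheaf p (st x).F).comap ψ := by
    intro x hx
    obtain ⟨hxc, hord⟩ := (hmem x).mp hx
    set a := (exists_eq_vanishingIdeal_cons_of_isClosed hxc).choose with ha
    set b := (exists_eq_vanishingIdeal_cons_of_isClosed hxc).choose_spec.choose with hb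
    have hxab : x.asIdeal = MvPolynomial.vanishingIdeal K {(Fin.cons a b : Fin (4 + 1) → K)} :=
      (exists_eq_vanishingIdeal_cons_of_isClosed hxc).choose_spec.choose_spec
    have hstx : st x = ⟨deletePthPowers p (PointBlowup.translate b F), 0, ∅⟩ := by
      rw [hst]
      exact dif_pos hxc
    have hord' := (natCast_le_idealOrder_hypSheaf_iff (p := p) F hxab p).mp hord
    rw [natCast_le_ordZero_translate_hyp_iff] at hord'
    obtain ⟨hab, H⟩ := hord'
    obtain ⟨φ, _, hφ, hMφ⟩ := exists_chart_recenter (p := p) F a b hab hxab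
    rw [hstx]
    exact ⟨deletePthPowers_translate_ne_zero hF hclean b, isClean_deletePthPowers _,
      ordAlong_univ_deletePthPowers_translate F b H, hacc a b hab H, P 4 K, φ, 𝟙 _, inferInstance, inferInstance,
      ξ 4 K, hφ, rfl, by rw [Scheme.IdealSheafData.comap_id]; exact hMφ⟩
  -- the root multiset is accessible for the hydra relation
  haveI : Std.Irrefl (fun s' s : State K => Edge p Finset.univ s s' ∧ s' ≠ s) := ⟨fun s hs => hs.2 rfl⟩
  have hT : Acc (Relation.CutExpand (fun s' s : State K => Edge p Finset.univ s s' ∧ s' ≠ s)) (pts.val.map st) := by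
    refine Relation.acc_of_singleton fun s hs => ?_
    rw [Multiset.mem_map] at hs
    obtain ⟨x, hx, rfl⟩ := hs
    exact (Subrelation.accessible (fun hs => hs.1) (hdata x (Finset.mem_val.mp hx)).2.2.2.1).cutExpand
  exact exists_isMarkedResolution_of_config M₀ hE₀ rfl hfin _ hT (P 4 K) (𝟙 _) M₀ (IsMultipleBlowup.refl _) pts st
    rfl (fun x hx => ((hmem x).mp hx).1) (fun z hz hzo => (hmem z).mpr ⟨hz, hzo⟩) hdata

end AllRoots

end Equimultiple

end Summit.ResolutionOfSingularities.ResolutionOfSingularities.Theorems.PIDim4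

end
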